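import Summits.RiemannHypothesis.RiemannHypothesis.Theorems.WeilColumnBSplineScaling
import HarnessLib

/-!
# The PART XIX profile in CDF form, its sup bound, and its TOP LAYER (RH-FREE; W2 of THETA-ASSIGN, profile half)

Cell `rh-explicit`, WEIL column, seat handoff-prove-2 gen12.  With `Φ = bsplineCDF (ε/m) (m−1)` (W1 `WeilColumnBSplineCDF`):

* `weilConv_indicatorConst_bsplineDensity`: `(a·1_{[s,t]} ⋆ ρ)(y) = a·(Φ_ρ(y−s) − Φ_ρ(y−t))`;
* **`profile_eq_cdf`**: `profile c₁ m₀ c₂ ε α m y = (1+α)·Φ(y−m₀) − Φ(y−(c₂−ε)) − α·Φ(y−(c₁+ε))` (THETA-CERT §0, PART XIX.1);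
* `profile_conj` (real-valued), **`norm_profile_le`**: `‖h(y)‖ ≤ max 1 α` for `α ≥ 0` (= `h_max`);
* **TOP LAYER** `profile_top_eq`: for `0 ≤ τ` with `c₂ − ε·τ ≥ m₀ + ε`: `h(c₂ − ε·τ) = 1 − bsplineCDF (1/m) (m−1) (1 − τ)`
  (`= P.Rtop τ`; the hypothesis `htop` of D4's `ThetaAtom.integral_top_eq` after `Θ(e^{a−w}) = h(c₂e^{−w})` and
  `c₂ e^{−w} = c₂ − ε·τ₁(w)`).
Nothing here bears on the truth of RH.
-/

noncomputable section

set_option linter.dupNamespace false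

open Complex Set MeasureTheory Filter
open scoped Real Topology ComplexConjugate

namespace Summit.RiemannHypothesis.RiemannHypothesis.Theorems.WeilColumn.ThetaMellin

open Literature.NumberTheory.LFunctions ThetaParams

variable {c : ℝ}

/-! ## §1 An interval indicator against a B-spline density -/

/-- `(a·1_{[s,t]} ⋆ ρ_k)(y) = a·(Φ(y − s) − Φ(y − t))`, `Φ = bsplineCDF c k`, for `s ≤ t`. [folklore] -/
theorem weilConv_indicatorConst_bsplineDensity {s t : ℝ} (hst : s ≤ t) (a : ℂ) (c : ℝ) (k : ℕ) (y : ℝ) :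
    weilConv (indicatorConst s t a) (bsplineDensity c k) y =
      a * (((bsplineCDF c k (y - s) - bsplineCDF c k (y - t) : ℝ)) : ℂ) := by
  rw [weilConv_apply]
  have hint := integrable_bsplineDensity_re c k
  have hfun : (fun u ↦ indicatorConst s t a u * bsplineDensity c k (y - u)) =
      (Icc s t).indicator fun u ↦ a * ((((bsplineDensity c k (y - u)).re : ℝ)) : ℂ) := by
    funext u
    simp only [indicatorConst, Set.indicator_apply]
    split_ifs with h
    · rw [← bsplineDensity_eq_ofReal_re]
    · rw [zero_mul]
  rw [hfun, integral_indicator measurableSet_Icc, integral_const_mul, integral_Icc_eq_integral_Ioc,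
    ← intervalIntegral.integral_of_le hst, intervalIntegral.integral_ofReal,
    intervalIntegral.integral_comp_sub_left (fun w ↦ (bsplineDensity c k w).re) y,
    ← intervalIntegral.integral_Iic_sub_Iic hint.integrableOn hint.integrableOn]
  rfl

/-! ## §2 The profile in CDF form -/

/-- Integrability of `u ↦ 1_{[s,t]}·a · ρ(y − u)` for a continuous bounded-support-free density (`k ≥ 1`, `c > 0`). -/
theorem integrable_indicatorConst_mul_bsplineDensity (hc : 0 < c) {k : ℕ} (hk : 1 ≤ k) (s t : ℝ) (a : ℂ) (y : ℝ) :
    Integrable fun u ↦ indicatorConst s t a u * bsplineDensity c k (y - u) := by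
  have hcont : Continuous fun u : ℝ ↦ bsplineDensity c k (y - u) :=
    (continuous_bsplineDensity hc hk).comp (continuous_const.sub continuous_id)
  refine ((integrable_indicatorConst s t a).bdd_mul hcont.aestronglyMeasurable
    (Eventually.of_forall fun u ↦ norm_bsplineDensity_le hc k (y - u))).congr
    (Eventually.of_forall fun u ↦ by simp [mul_comm])

/-- **`h = h₀ ⋆ ρ_ε` in CDF form**: `profile c₁ m₀ c₂ ε α m y = (1+α)Φ(y−m₀) − Φ(y−(c₂−ε)) − αΦ(y−(c₁+ε))`,
`Φ = bsplineCDF (ε/m) (m−1)`, for `m ≥ 2`, `ε > 0`, `c₁ + ε ≤ m₀ ≤ c₂ − ε`. [this cell: THETA-CERT-cc6 §0; PART XIX.1] -/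
theorem profile_eq_cdf {c₁ m₀ c₂ ε α : ℝ} {m : ℕ} (hm : 2 ≤ m) (hε : 0 < ε) (h1 : m₀ ≤ c₂ - ε) (h2 : c₁ + ε ≤ m₀)
    (y : ℝ) :
    profile c₁ m₀ c₂ ε α m y =
      ((((1 + α) * bsplineCDF (ε / m) (m - 1) (y - m₀) - bsplineCDF (ε / m) (m - 1) (y - (c₂ - ε)) -
        α * bsplineCDF (ε / m) (m - 1) (y - (c₁ + ε)) : ℝ)) : ℂ) := by
  have hmc : 0 < ε / m := div_pos hε (by exact_mod_cast (by omega : 0 < m))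
  have hk : 1 ≤ m - 1 := by omega
  have hA := weilConv_indicatorConst_bsplineDensity h1 (1 : ℂ) (ε / m) (m - 1) y
  have hB := weilConv_indicatorConst_bsplineDensity h2 (α : ℂ) (ε / m) (m - 1) y
  rw [weilConv_apply] at hA hB
  have iA := integrable_indicatorConst_mul_bsplineDensity hmc hk m₀ (c₂ - ε) (1 : ℂ) y
  have iB := integrable_indicatorConst_mul_bsplineDensity hmc hk (c₁ + ε) m₀ (α : ℂ) y
  rw [profile, weilConv_apply]
  have hfun : (fun u ↦ stepProfile c₁ m₀ c₂ ε α u * bsplineDensity (ε / m) (m - 1) (y - u)) =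
      fun u ↦ indicatorConst m₀ (c₂ - ε) 1 u * bsplineDensity (ε / m) (m - 1) (y - u) -
        indicatorConst (c₁ + ε) m₀ (α : ℂ) u * bsplineDensity (ε / m) (m - 1) (y - u) := by
    funext u; simp only [stepProfile, Pi.sub_apply]; ring
  rw [hfun, integral_sub iA iB, hA, hB]
  push_cast
  ring

/-! ## §3 Real-valuedness and the sup bound `‖h‖ ≤ max 1 α` -/

/-- The profile is real-valued (`m ≥ 2`, `ε > 0`, seed inequalities). -/
theorem profile_conj {c₁ m₀ c₂ ε α : ℝ} {m : ℕ} (hm : 2 ≤ m) (hε : 0 < ε) (h1 : m₀ ≤ c₂ - ε) (h2 : c₁ + ε ≤ m₀)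
    (y : ℝ) : conj (profile c₁ m₀ c₂ ε α m y) = profile c₁ m₀ c₂ ε α m y := by
  rw [profile_eq_cdf hm hε h1 h2, Complex.conj_ofReal]

/-- **`‖h(y)‖ ≤ max 1 α`** for `α ≥ 0` (`h = (Φ₂ − Φ₃) − α(Φ₁ − Φ₂)` with `1 ≥ Φ₁ ≥ Φ₂ ≥ Φ₃ ≥ 0`). [THETA-CERT-cc6 §D (h_max)] -/
theorem norm_profile_le {c₁ m₀ c₂ ε α : ℝ} {m : ℕ} (hm : 2 ≤ m) (hε : 0 < ε) (h1 : m₀ ≤ c₂ - ε) (h2 : c₁ + ε ≤ m₀)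
    (hα : 0 ≤ α) (y : ℝ) : ‖profile c₁ m₀ c₂ ε α m y‖ ≤ max 1 α := by
  have hmc : 0 < ε / m := div_pos hε (by exact_mod_cast (by omega : 0 < m))
  rw [profile_eq_cdf hm hε h1 h2, Complex.norm_real, Real.norm_eq_abs, abs_le]
  set Φ := bsplineCDF (ε / m) (m - 1) with hΦ
  have hmono := bsplineCDF_mono hmc.le (m - 1)
  have h12 : Φ (y - m₀) ≤ Φ (y - (c₁ + ε)) := hmono (by linarith)
  have h23 : Φ (y - (c₂ - ε)) ≤ Φ (y - m₀) := hmono (by linarith)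
  have hΦ0 : 0 ≤ Φ (y - (c₂ - ε)) := bsplineCDF_nonneg hmc.le _ _
  have hΦ1 : Φ (y - (c₁ + ε)) ≤ 1 := bsplineCDF_le_one hmc _ _
  have p1 : 0 ≤ α * (Φ (y - (c₁ + ε)) - Φ (y - m₀)) := mul_nonneg hα (sub_nonneg.2 h12)
  have p2 : α * (Φ (y - (c₁ + ε)) - Φ (y - m₀)) ≤ α * 1 := mul_le_mul_of_nonneg_left (by linarith) hα
  have hm1 := le_max_left (1 : ℝ) α
  have hm2 := le_max_right (1 : ℝ) α
  constructor
  · nlinarith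
  · nlinarith

/-! ## §4 The top layer: `h(c₂ − ετ) = 1 − F(1 − τ) = P.Rtop τ` -/

/-- **TOP LAYER of the profile**: for `m ≥ 2`, `ε > 0`, `c₁ + ε ≤ m₀ ≤ c₂ − ε`, and `τ` with `m₀ + ε ≤ c₂ − ε·τ`:
`profile … (c₂ − ε·τ) = 1 − bsplineCDF (1/m) (m−1) (1 − τ)` (the interface's `Rtop τ`). [THETA-CERT-cc6 §D4] -/
theorem profile_top_eq {c₁ m₀ c₂ ε α : ℝ} {m : ℕ} (hm : 2 ≤ m) (hε : 0 < ε) (h1 : m₀ ≤ c₂ - ε) (h2 : c₁ + ε ≤ m₀)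
    {τ : ℝ} (hτ : m₀ + ε ≤ c₂ - ε * τ) :
    profile c₁ m₀ c₂ ε α m (c₂ - ε * τ) = (((1 - bsplineCDF (1 / m) (m - 1) (1 - τ) : ℝ)) : ℂ) := by
  have hm0 : (0 : ℝ) < m := by exact_mod_cast (by omega : 0 < m)
  have hmc : 0 < ε / m := div_pos hε hm0
  have hcast : (((m - 1 : ℕ) : ℝ) + 1) * (ε / m) = ε := by
    rw [Nat.cast_sub (by omega)]; push_cast; field_simp; ring
  have hΦ1 : bsplineCDF (ε / m) (m - 1) (c₂ - ε * τ - m₀) = 1 :=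
    bsplineCDF_eq_one hmc _ (by rw [hcast]; linarith)
  have hΦ2 : bsplineCDF (ε / m) (m - 1) (c₂ - ε * τ - (c₁ + ε)) = 1 :=
    bsplineCDF_eq_one hmc _ (by rw [hcast]; linarith)
  have hscale := bsplineCDF_scale hε (1 / (m : ℝ)) (m - 1) (1 - τ)
  rw [profile_eq_cdf hm hε h1 h2, hΦ1, hΦ2, show c₂ - ε * τ - (c₂ - ε) = ε * (1 - τ) by ring,
    show ε / (m : ℝ) = ε * (1 / m) by ring, hscale]
  push_cast
  ring

end Summit.RiemannHypothesis.RiemannHypothesis.Theorems.WeilColumn.ThetaMellin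

end
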